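import Literature.MathematicalPhysics.QuantumLattice.FermionOperators
import HarnessLib

/-!
# Hermiticity of the Hubbard spin vector (discharge of `spinVecF_isHermitian`)

Trunk T-QLATTICE, family `hubbard`. Sibling proof file of
`Literature/MathematicalPhysics/QuantumLattice/FermionOperators.lean`: the discharge
`spinVecF_isHermitian_holds` of the named fact
`Literature.MathematicalPhysics.QuantumLattice.spinVecF_isHermitian` (the three components of
the Hubbard total-spin vector `spinVecF = (S^x, S^y, S^z)` are Hermitian matrices on the Fock
space `Fock (Orb Λ)`). Everything is PROVED from the wave-0 Jordan–Wigner matrices; no statement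
is introduced or changed.

## Proof

`S^x = (S⁺ + S⁻)/2` and `S^y = -i (S⁺ - S⁻)/2` are Hermitian because `S⁻ = (S⁺)ᴴ` (`spinMinus`
is *defined* as `spinPlusᴴ`) together with `conj (1/2) = 1/2`, `conj (-i/2) = i/2`; and
`S^z = ½ Σ_x (n_{x↑} - n_{x↓})` is Hermitian because every `n_{xσ} = c†_{xσ} c_{xσ}` is
(`numberAt_isHermitian`).

## Source read

H. Tasaki, *The Hubbard model — an introduction and selected rigorous results*, J. Phys.:
Condens. Matter **10** (1998) 4353 (arXiv:cond-mat/9512169), §2.2 "Some physical quantities":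
the spin operators `S^{(α)}_x = ½ Σ_{σ,τ} c†_{xσ} (p^{(α)})_{στ} c_{xτ}` with `p^{(α)}` the Pauli
matrices, and `S^{(α)}_{tot} = Σ_x S^{(α)}_x` (`α = 1, 2, 3`). Expanding the Pauli matrices gives
exactly the three entries `(S⁺ + S⁻)/2`, `-i (S⁺ - S⁻)/2`, `½ Σ_x (n_{x↑} - n_{x↓})` of
`spinVecF` (with `S⁺ = Σ_x c†_{x↑} c_{x↓}`), which are manifestly self-adjoint since the `p^{(α)}`
are Hermitian. H. Tasaki, *Physics and Mathematics of Quantum Many-Body Systems* (Springer GTP,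
2020) §9.3 uses the same definitions (the locator carried by the vendored fact).
-/

namespace Literature.MathematicalPhysics.QuantumLattice

open Matrix Finset HubbardWave0

variable {Λ : Type*} [LinearOrder Λ] [Fintype Λ]

/-- `(S⁻)ᴴ = S⁺` (as `S⁻ := (S⁺)ᴴ`). Lieb, PRL 62 (1989) 1201. [folklore] -/
@[simp] theorem spinMinus_conjTranspose :
    (spinMinus : Matrix (Finset (Orb Λ)) (Finset (Orb Λ)) ℂ)ᴴ = spinPlus :=
  conjTranspose_conjTranspose _

/-- `S^x = (S⁺ + S⁻)/2` is Hermitian. Tasaki (1998) §2.2; Tasaki (2020) §9.3.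
[cite: Tasaki1998, §2.2] -/
theorem isHermitian_half_smul_spinPlus_add_spinMinus :
    ((1 / 2 : ℂ) • (spinPlus + spinMinus) : Matrix (Finset (Orb Λ)) (Finset (Orb Λ)) ℂ).IsHermitian := by
  unfold Matrix.IsHermitian
  rw [conjTranspose_smul, conjTranspose_add, spinMinus_conjTranspose, spinMinus, add_comm]
  congr 1
  simp

/-- `S^y = -i (S⁺ - S⁻)/2` is Hermitian. Tasaki (1998) §2.2; Tasaki (2020) §9.3.
[cite: Tasaki1998, §2.2] -/
theorem isHermitian_negI_half_smul_spinPlus_sub_spinMinus :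
    ((-Complex.I / 2) • (spinPlus - spinMinus) :
      Matrix (Finset (Orb Λ)) (Finset (Orb Λ)) ℂ).IsHermitian := by
  unfold Matrix.IsHermitian
  rw [conjTranspose_smul, conjTranspose_sub, spinMinus_conjTranspose, spinMinus,
    ← neg_sub spinPlus, smul_neg, ← neg_smul]
  congr 1
  rw [Complex.star_def, map_div₀, map_neg, Complex.conj_I, map_ofNat]
  ring

/-- `S^z = ½ Σ_x (n_{x↑} - n_{x↓})` is Hermitian (each `n_{xσ}` is). Tasaki (1998) §2.2;
Tasaki (2020) §9.3. [cite: Tasaki1998, §2.2] -/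
theorem HubbardWave0.spinZ_isHermitian :
    (spinZ : Matrix (Finset (Orb Λ)) (Finset (Orb Λ)) ℂ).IsHermitian := by
  have hn : ∀ (x : Λ) (σ : Fin 2),
      (QuantumLattice.numberOp x σ : Matrix (Finset (Orb Λ)) (Finset (Orb Λ)) ℂ)ᴴ =
        QuantumLattice.numberOp x σ :=
    fun x σ => (numberAt_isHermitian (orb x σ)).eq
  unfold HubbardWave0.spinZ Matrix.IsHermitian
  simp only [conjTranspose_smul, conjTranspose_sum, conjTranspose_sub, hn]
  congr 1
  simp

/-- **Discharge of `Literature.MathematicalPhysics.QuantumLattice.spinVecF_isHermitian`**: the spin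
components `S^x, S^y, S^z` of the Hubbard model are Hermitian. Tasaki (1998) §2.2 (spin
operators built from the Hermitian Pauli matrices); Tasaki (2020) §9.3.
[cite: Tasaki1998, §2.2] [cite: Tasaki2020, §9.3] -/
theorem spinVecF_isHermitian_holds : spinVecF_isHermitian (Λ := Λ) := by
  intro α
  fin_cases α
  · exact isHermitian_half_smul_spinPlus_add_spinMinus
  · exact isHermitian_negI_half_smul_spinPlus_sub_spinMinus
  · exact HubbardWave0.spinZ_isHermitian

end Literature.MathematicalPhysics.QuantumLattice
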